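import Mathlib
import Summits.ValiantsHypothesis.ValiantsHypothesis.Theorems.LiouvilleSarnakLiouvilleCutRankCertifiedCutPoints
import Summits.ValiantsHypothesis.ValiantsHypothesis.Theorems.LiouvilleSarnakLiouvilleCutRankNoAdjacentRows
import Literature.Computability.AlgebraicComplexity.BooleanGadgets
import HarnessLib

/-!
# Route LiouvilleSarnak — crux `LiouvilleCutRank` (stmt-ValiantsHypothesis-14775):
# SHIFT CERTIFICATES: no two row bits at distance `d` (`λ(2^d+1) = -1`) ⟹ explicit rank lower bound

Generalisation of `Theorems/LiouvilleSarnakLiouvilleCutRankNoAdjacentRows.lean` (the case `d = 1`) to an arbitrary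
shift `d ≥ 1` with `λ(2^d + 1) = -1` (`d = 1, 2, 4, 8, 10, 14, 16, …`): for an ARBITRARY cut `π` of the `2n` bit
positions with NO TWO ROW POSITIONS AT DISTANCE EXACTLY `d`, every row position `j` followed by `d` non-row positions
(`j+1, …, j+d` not rows, `j + d < 2n`) yields a cut point `p = j + 1`, and these cut points are pairwise certified with
`c = 2^d + 1` (`m = 2^d x`, the bits of `x - 1` sit `d` places before later row positions — columns by the hypothesis —
or before the first row position after `p`):

* ★★ `card_le_two_pow_rank_of_shift` — `#{such j} ≤ 2^{rank M_π}`.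
  For `d = 2` this covers e.g. all cut words whose `R`-runs have length `≤ 2` and whose `C`-runs have length `≥ 2`
  (`(RRCC)^m`, …) with `rank ≥ log₂(#R-runs)`; for `d = 1` it is `…NoAdjacentRows` (`n ≤ 2^{rank}`).

Honest framing: explicit classes of the crux with explicit rates; `LiouvilleCutRank` (ALL balanced cuts),
`DigitalBilinearLiouville`, `AlgebraicSarnak` stay OPEN; nothing bears on `VP ≠ VNP`.  No definitions.
-/

set_option linter.dupNamespace false

noncomputable section

namespace Summit.ValiantsHypothesis.ValiantsHypothesis.Theorems.LiouvilleSarnakLiouvilleCutRank.ShiftCertificates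

open ArithmeticFunction Finset

open Summit.ValiantsHypothesis.ValiantsHypothesis.Theorems.LiouvilleSarnakLiouvilleCutRank.CertifiedCutPoints
  (card_le_two_pow_rank_of_certified)
open Literature.Computability.AlgebraicComplexity.BoolGadgets (ofBits_eq_sum)
open Summit.ValiantsHypothesis.ValiantsHypothesis.Theorems.LiouvilleSarnakLiouvilleCutRank.NoAdjacentRows
  (ofBits_split_min)

/-- ★★ **Shift certificates.**  Let `d ≥ 1` with `λ(2^d + 1) = -1`, and let `π` be a cut of the `2n` bit
positions with no two ROW positions at distance exactly `d`.  Then the number of row positions `j` with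
`j + d < 2n` and no row position in `(j, j + d]` is at most `2^{rank M_π}`. [this file] -/
theorem card_le_two_pow_rank_of_shift (n d : ℕ) (hd : 1 ≤ d) (hl : liouville (2 ^ d + 1) = -1)
    (π : Fin n ⊕ Fin n ≃ Fin (2 * n))
    (hRR : ∀ i i' : Fin n, (π (Sum.inl i') : ℕ) ≠ (π (Sum.inl i) : ℕ) + d) :
    ((Finset.univ : Finset (Fin n)).filter (fun i => (π (Sum.inl i) : ℕ) + d < 2 * n ∧
        ∀ i' : Fin n, ¬ ((π (Sum.inl i) : ℕ) < (π (Sum.inl i') : ℕ) ∧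
          (π (Sum.inl i') : ℕ) ≤ (π (Sum.inl i) : ℕ) + d))).card ≤
      2 ^ (Matrix.of fun r c : Fin n → Bool =>
        (((liouville (Nat.ofBits (fun k : Fin (2 * n) => Sum.elim r c (π.symm k)) + 1) : ℤ) : ℂ))).rank := by
  classical
  set S := (Finset.univ : Finset (Fin n)).filter (fun i => (π (Sum.inl i) : ℕ) + d < 2 * n ∧
        ∀ i' : Fin n, ¬ ((π (Sum.inl i) : ℕ) < (π (Sum.inl i') : ℕ) ∧
          (π (Sum.inl i') : ℕ) ≤ (π (Sum.inl i) : ℕ) + d)) with hS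
  -- positions: a position with `isLeft = false` is a column position; `isLeft = true` is a row position
  have hcol : ∀ j : Fin (2 * n), (π.symm j).isLeft = false → ∃ i : Fin n, (π (Sum.inr i) : ℕ) = j := by
    intro j h
    rcases hj : π.symm j with i | i
    · rw [hj] at h; simp at h
    · exact ⟨i, by rw [← hj, Equiv.apply_symm_apply]⟩
  have hrow : ∀ j : Fin (2 * n), (π.symm j).isLeft = true → ∃ i : Fin n, (π (Sum.inl i) : ℕ) = j := by
    intro j h
    rcases hj : π.symm j with i | i
    · exact ⟨i, by rw [← hj, Equiv.apply_symm_apply]⟩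
    · rw [hj] at h; simp at h
  -- for `i ∈ S`: the positions `(π(inl i), π(inl i) + d]` are not rows
  have hgap : ∀ i ∈ S, ∀ j : Fin (2 * n), (π (Sum.inl i) : ℕ) < j → (j : ℕ) ≤ (π (Sum.inl i) : ℕ) + d →
      (π.symm j).isLeft = false := by
    intro i hi j h1 h2
    rw [hS, Finset.mem_filter] at hi
    by_contra h
    rw [Bool.not_eq_false] at h
    obtain ⟨i', hi'⟩ := hrow j h
    exact hi.2.2 i' ⟨by omega, by omega⟩
  have key := card_le_two_pow_rank_of_certified n π (S.image fun i => (π (Sum.inl i) : ℕ) + 1)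
    (fun p hp => by
      obtain ⟨i, -, rfl⟩ := Finset.mem_image.mp hp
      have := (π (Sum.inl i)).2; omega)
    (fun p hp p' hp' hpp' => by
      obtain ⟨i, hiS, rfl⟩ := Finset.mem_image.mp hp
      obtain ⟨i', hi'S, rfl⟩ := Finset.mem_image.mp hp'
      -- abbreviations
      set p := (π (Sum.inl i) : ℕ) + 1 with hpdef
      set p' := (π (Sum.inl i') : ℕ) + 1 with hp'def
      have hidn : (π (Sum.inl i) : ℕ) + d < 2 * n := by
        have := hiS; rw [hS, Finset.mem_filter] at this; exact this.2.1
      have hii' : p + d ≤ (π (Sum.inl i') : ℕ) := by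
        have h1 : (π (Sum.inl i) : ℕ) < (π (Sum.inl i') : ℕ) := by omega
        have h2 := hgap i hiS (π (Sum.inl i')) h1
        rw [Equiv.symm_apply_apply] at h2
        simp only [Sum.isLeft_inl] at h2
        by_contra h
        exact absurd (h2 (by omega)) (by simp)
      -- the bit function of the exponents `e = j - p - d` of row positions `j ∈ [p+d, p')`
      set G : ℕ → Bool := fun e => if h : p + d + e < 2 * n then
        decide (p + d + e < p') && (π.symm ⟨p + d + e, h⟩).isLeft else false with hGdef
      have hGN : ∀ e, 2 * n ≤ e → G e = false := fun e he => by
        rw [hGdef]; simp only; rw [dif_neg (by omega)]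
      have hGlt : ∀ e, G e = true → p + d + e < 2 * n := by
        intro e he
        by_contra h
        rw [hGdef] at he; simp only at he; rw [dif_neg h] at he
        exact Bool.false_ne_true he
      have hGp' : ∀ e, G e = true → p + d + e < p' := by
        intro e he
        have h := hGlt e he
        rw [hGdef] at he; simp only at he; rw [dif_pos h] at he
        simp only [Bool.and_eq_true, decide_eq_true_eq] at he
        exact he.1
      have hGleft : ∀ e (he : G e = true), (π.symm ⟨p + d + e, hGlt e he⟩).isLeft = true := by
        intro e he
        have h := hGlt e he
        have he' := he
        rw [hGdef] at he'; simp only at he'; rw [dif_pos h] at he'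
        simp only [Bool.and_eq_true, decide_eq_true_eq] at he'
        exact he'.2
      have hGintro : ∀ e (h : p + d + e < 2 * n), p + d + e < p' →
          (π.symm ⟨p + d + e, h⟩).isLeft = true → G e = true := by
        intro e h h1 h2
        rw [hGdef]; simp only; rw [dif_pos h]
        simp only [Bool.and_eq_true, decide_eq_true_eq]
        exact ⟨h1, h2⟩
      -- `e₁ = π(inl i') - p - d` is an exponent
      have he₁ : G ((π (Sum.inl i') : ℕ) - p - d) = true := by
        have hlt : p + d + ((π (Sum.inl i') : ℕ) - p - d) < 2 * n := by have := (π (Sum.inl i')).2; omega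
        refine hGintro _ hlt (by omega) ?_
        have hj : (⟨p + d + ((π (Sum.inl i') : ℕ) - p - d), hlt⟩ : Fin (2 * n)) = π (Sum.inl i') :=
          Fin.ext (by simp only; omega)
        rw [hj, Equiv.symm_apply_apply]; rfl
      -- the least exponent
      have hex : ∃ e, G e = true := ⟨_, he₁⟩
      obtain ⟨e₀, hG0, hmin'⟩ : ∃ e₀, G e₀ = true ∧ ∀ e, e < e₀ → G e = false :=
        ⟨Nat.find hex, Nat.find_spec hex, fun e he => by
          have := Nat.find_min hex he; simpa using this⟩
      have h0N := hGlt e₀ hG0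
      have h0p' := hGp' e₀ hG0
      -- the certificate `x`
      have hxsplit := ofBits_split_min (2 * n) G hGN e₀ hG0 hmin'
      have hx1 : 1 ≤ Nat.ofBits (fun e : Fin (2 * n) => G e) := by
        rw [hxsplit]; have := Nat.one_le_two_pow (n := e₀); omega
      refine ⟨2 ^ d + 1, Nat.ofBits (fun e : Fin (2 * n) => G e), hl, hx1, ?_, ?_⟩
      · -- `x * 2^d = m`: reindex `e ↦ j = p + d + e`
        rw [Nat.add_sub_cancel]
        have hGne : ∀ e : Fin (2 * n), (G e).toNat * 2 ^ (e : ℕ) * 2 ^ d ≠ 0 → G e = true := by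
          intro e hne
          by_contra h
          rw [Bool.not_eq_true] at h
          rw [h] at hne
          simp at hne
        rw [ofBits_eq_sum, Finset.sum_mul]
        refine Finset.sum_bij_ne_zero (fun e _ hne => (⟨p + d + (e : ℕ), hGlt e (hGne e hne)⟩ : Fin (2 * n)))
          (fun e _ hne => Finset.mem_univ _) (fun e₁ _ _ e₂ _ _ h => by
            have := congrArg Fin.val h; exact Fin.ext (by simp only at this; omega)) ?_ ?_
        · -- surjectivity onto the support
          intro j _ hne
          have hc : p ≤ (j : ℕ) ∧ (j : ℕ) < p' ∧ (π.symm j).isLeft = true := by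
            by_contra h; exact hne (if_neg h)
          have hjp : p + d ≤ (j : ℕ) := by
            by_contra h
            have := hgap i hiS j (by omega) (by omega)
            rw [hc.2.2] at this
            exact Bool.noConfusion this
          have hjlt : (j : ℕ) - p - d < 2 * n := by have := j.2; omega
          have hG : G ((j : ℕ) - p - d) = true := by
            have hlt : p + d + ((j : ℕ) - p - d) < 2 * n := by have := j.2; omega
            refine hGintro _ hlt (by omega) ?_
            have hj : (⟨p + d + ((j : ℕ) - p - d), hlt⟩ : Fin (2 * n)) = j := Fin.ext (by simp only; omega)
            rw [hj]; exact hc.2.2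
          refine ⟨⟨(j : ℕ) - p - d, hjlt⟩, Finset.mem_univ _, ?_, Fin.ext (by simp only; omega)⟩
          simp only [hG, Bool.toNat_true, one_mul]
          positivity
        · -- values agree
          intro e _ hne
          have hG := hGne e hne
          rw [if_pos ⟨by simp only; omega, by have := hGp' e hG; simp only; omega, hGleft e hG⟩]
          simp only [hG, Bool.toNat_true, one_mul]
          rw [show p + d + (e : ℕ) - p = (e : ℕ) + d by omega, pow_add]
      · -- bits of `x - 1` sit at column positions `p + b`
        intro b hb
        have hxm1 : Nat.ofBits (fun e : Fin (2 * n) => G e) - 1 =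
            2 ^ (e₀ + 1) * Nat.ofBits (fun e : Fin (2 * n) => G ((e : ℕ) + e₀ + 1)) + (2 ^ e₀ - 1) := by
          rw [hxsplit]; have := Nat.one_le_two_pow (n := e₀); omega
        rw [hxm1, Nat.testBit_two_pow_mul_add _ (by
            have := Nat.one_le_two_pow (n := e₀)
            have := Nat.pow_lt_pow_right (by norm_num : 1 < 2) (Nat.lt_succ_self e₀)
            omega : 2 ^ e₀ - 1 < 2 ^ (e₀ + 1)),
          Nat.testBit_two_pow_sub_one, Nat.testBit_ofBits] at hb
        by_cases hb0 : b < e₀ + 1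
        · -- low bits: `b < e₀`; position `p + b` precedes the first row position `p + d + e₀` after `p`
          rw [if_pos hb0, decide_eq_true_eq] at hb
          have hqn : p + b < 2 * n := by omega
          refine hcol ⟨p + b, hqn⟩ ?_
          by_cases hbd : b < d
          · exact hgap i hiS ⟨p + b, hqn⟩ (by simp only; omega) (by simp only; omega)
          · by_contra hleft
            rw [Bool.not_eq_false] at hleft
            have hG' : G (b - d) = true := by
              have hlt : p + d + (b - d) < 2 * n := by omega
              refine hGintro _ hlt (by omega) ?_
              have hj : (⟨p + d + (b - d), hlt⟩ : Fin (2 * n)) = ⟨p + b, hqn⟩ := Fin.ext (by simp only; omega)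
              rw [hj]; exact hleft
            rw [hmin' (b - d) (by omega)] at hG'
            exact Bool.false_ne_true hG'
        · -- high bits: `b > e₀` with `G b = true`; position `p + b = j - d` for the row position `j = p + d + b`
          rw [if_neg hb0] at hb
          by_cases hbN : b - (e₀ + 1) < 2 * n
          · rw [dif_pos hbN] at hb
            have hb' : G b = true := by rwa [show b - (e₀ + 1) + e₀ + 1 = b by omega] at hb
            have hblt := hGlt b hb'
            have hqn : p + b < 2 * n := by omega
            refine hcol ⟨p + b, hqn⟩ ?_
            by_contra hleft
            rw [Bool.not_eq_false] at hleft
            obtain ⟨i₁, hi₁⟩ := hrow ⟨p + b, hqn⟩ hleft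
            obtain ⟨i₂, hi₂⟩ := hrow ⟨p + d + b, hblt⟩ (hGleft b hb')
            simp only at hi₁ hi₂
            exact hRR i₁ i₂ (by omega)
          · rw [dif_neg hbN] at hb
            exact absurd hb Bool.false_ne_true)
  rwa [Finset.card_image_of_injOn (fun a _ b _ h => by
      have : (π (Sum.inl a) : ℕ) = (π (Sum.inl b) : ℕ) := by simpa using h
      exact Sum.inl_injective (π.injective (Fin.ext this)))] at key

end Summit.ValiantsHypothesis.ValiantsHypothesis.Theorems.LiouvilleSarnakLiouvilleCutRank.ShiftCertificates

end
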